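import Summits.ResolutionOfSingularities.ResolutionOfSingularities.Theorems.FrobeniusLadderFInjectiveMacaulayficationRelGddF192Direct
import Summits.ResolutionOfSingularities.ResolutionOfSingularities.Theorems.FrobeniusLadderFInjectiveMacaulayficationGradedChartClauseAssembly
import Mathlib.Logic.Equiv.Fin.Basic
import HarnessLib

/-!
# ROWC row F021 at `p = 5`: the DIRECT Fedder certificate of the deformation `gh` at the points over the bad cone orbit
# (crux `FInjectiveMacaulayfication` stmt-ResolutionOfSingularities-15315, relative filtered engine v2 `FilteredConeFiModelRelDirect` —
# the `Or.inl` branch of its `hcone`; RULING R16.30 (5) of res-L1-w45a-plan-1, third clone)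

Support file for crux stmt-ResolutionOfSingularities-15315 (`FrobeniusLadder.FInjectiveMacaulayfication`), chain w45a, seat
res-L1-w45a-stub-4 g6. [OURS · L1 W4.5a; clone of `…RelGddF192Direct` for F021 = F192 + y⁴w²; the F192 FINDING 19:05:06Z (residual ROWC point FULL by plain Fedder; cross-checked
res-L1-w45a-tri-2 #167, res-L1-w45a-idea-2 ROWC v2 (D)-column)] — NOT a statement of the manuscript; AI-written, weaker than expert review.

The deformation to the weighted tangent cone of F021's diagonal form `g = z² + t⁴y²w⁴ + (y² + x³)³ + y⁴w² + x¹¹ + w⁷` along the facet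
`(2,3,9,3 | 0)`, `D = 18`, is `gh = z² + t⁴y²w⁴ + (y² + x³)³ + y⁴w² + x¹¹s⁴ + w⁷s³ ∈ k[x,y,z,w,t,s]` (`s = X none`; weights of `x¹¹`, `w⁷` are
`22`, `21`).  At the maximal ideals `P′ ∋ x, y, z, t, s`, `w ∉ P′` of `k[X,s]/(gh)` — the points of the extended-Rees `w`-chart lying over
the cone's bad orbit `O = {x=y=z=t=0}` — the ring IS F-pure: slicing `k[X,s] ≃ k[w][x,y,z,s,t]`, the `t⁴y²z⁴s³`-coefficient of `gh⁴` is
`12·w¹¹` EXACTLY (`coeff_direct`: binomial in `z`, kill `x`, explicit square), `12 ∈ k×`, `w¹¹ ∉ 𝔭` ⇒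
`FedderViaSlicing.clause_of_sliceCoeff` (`direct_clause_fin6`).  The engine states the deformation ring over `Option (Fin 5)`; we
transport along `rename finSuccEquivLast.symm : k[Option (Fin 5)] ≃ k[Fin 6]` and `Ideal.quotientEquiv` (`direct_clause`).
No definitions, no named facts. [folklore]
-/

-- single-problem summit: the doubled namespace component is forced
set_option linter.dupNamespace false

noncomputable section

namespace Summit.ResolutionOfSingularities.ResolutionOfSingularities.Theorems.FInjectiveMacaulayfication.RelGddF021Direct

open MvPolynomial IsLocalRing
open Summit.ResolutionOfSingularities.ResolutionOfSingularities.Theorems.FInjectiveMacaulayfication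

-- the `w`-base slicing of `k[X₀,…,X₅]` is `RelGddF192Direct.exists_wBaseSlicing6`

/-- **The `t⁴y²z⁴s³`-coefficient of `gh⁴` is `12·a·b`** (`a = w⁴`, `b = w⁷`, `c = w²`: the term `C(c)Y₁⁴ = y⁴w²` only feeds multiples of `Y₁⁴`).  In `k[w][Y₀,…,Y₄]` (`Y = x,y,z,s,t`) with `G = Y₂² + u`,
`u = C(a)Y₄⁴Y₁² + (Y₁² + Y₀³)³ + C(c)Y₁⁴ + Y₀¹¹Y₃⁴ + C(b)Y₃³`: binomial in `Y₂` (`6`), kill `Y₀`, and the explicit square of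
`C(a)Y₄⁴Y₁² + Y₁⁶ + C(b)Y₃³`, whose only term with exponents `(·,2,·,3,4)` is `2ab·Y₄⁴Y₁²Y₃³`. [folklore] -/
theorem coeff_direct (k : Type) [Field k] (a b c : MvPolynomial (Fin 1) k) :
    coeff (Finsupp.single (2 : Fin 5) (2 * 2) + (Finsupp.single 4 4 + Finsupp.single 1 2 + Finsupp.single 3 3))
      ((X 2 ^ 2 + (C a * X 4 ^ 4 * X 1 ^ 2 + (X 1 ^ 2 + X 0 ^ 3) ^ 3 + C c * X 1 ^ 4 + X 0 ^ 11 * X 3 ^ 4 + C b * X 3 ^ 3) :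
        MvPolynomial (Fin 5) (MvPolynomial (Fin 1) k)) ^ 4) = 6 * (2 * a * b) := by
  set u : MvPolynomial (Fin 5) (MvPolynomial (Fin 1) k) :=
    C a * X 4 ^ 4 * X 1 ^ 2 + (X 1 ^ 2 + X 0 ^ 3) ^ 3 + C c * X 1 ^ 4 + X 0 ^ 11 * X 3 ^ 4 + C b * X 3 ^ 3 with hu_def
  have hXdeg : ∀ (j : Fin 5), j ≠ 2 → ∀ n : ℕ, degreeOf 2 (X j ^ n : MvPolynomial (Fin 5) (MvPolynomial (Fin 1) k)) = 0 := by
    intro j hj n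
    apply Nat.eq_zero_of_le_zero
    refine (degreeOf_pow_le _ _ _).trans ?_
    rw [degreeOf_X, if_neg hj.symm, mul_zero]
  have hφdeg : degreeOf 2 (X 1 ^ 2 + X 0 ^ 3 : MvPolynomial (Fin 5) (MvPolynomial (Fin 1) k)) = 0 := by
    apply Nat.eq_zero_of_le_zero
    refine (degreeOf_add_le _ _ _).trans (max_le ?_ ?_)
    · rw [hXdeg 1 (by decide)]
    · rw [hXdeg 0 (by decide)]
  have hu : degreeOf 2 u = 0 := by
    apply Nat.eq_zero_of_le_zero
    refine (degreeOf_add_le _ _ _).trans (max_le ((degreeOf_add_le _ _ _).trans (max_le ((degreeOf_add_le _ _ _).trans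
      (max_le ((degreeOf_add_le _ _ _).trans (max_le ?_ ?_)) ?_)) ?_)) ?_)
    · refine (degreeOf_mul_le _ _ _).trans ?_
      rw [hXdeg 1 (by decide), add_zero]
      refine (degreeOf_mul_le _ _ _).trans ?_
      rw [degreeOf_C, hXdeg 4 (by decide)]
    · refine (degreeOf_pow_le _ _ _).trans ?_
      rw [hφdeg, mul_zero]
    · refine (degreeOf_mul_le _ _ _).trans ?_
      rw [degreeOf_C, hXdeg 1 (by decide)]
    · refine (degreeOf_mul_le _ _ _).trans ?_
      rw [hXdeg 0 (by decide), hXdeg 3 (by decide)]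
    · refine (degreeOf_mul_le _ _ _).trans ?_
      rw [degreeOf_C, hXdeg 3 (by decide)]
  rw [FedderViaSlicing.coeff_X_pow_add_pow 2 2 4 2 (by norm_num) (by norm_num) u hu _ (by simp),
    show (4 - 2 : ℕ) = 2 from rfl, show (Nat.choose 4 2 : MvPolynomial (Fin 1) k) = 6 by norm_num [Nat.choose]]
  congr 1
  -- kill `Y₀`
  have hdvd : (X 0 : MvPolynomial (Fin 5) (MvPolynomial (Fin 1) k)) ^ 1 ∣
      u - (C a * X 4 ^ 4 * X 1 ^ 2 + X 1 ^ 6 + C b * X 3 ^ 3 + C c * X 1 ^ 4) :=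
    ⟨X 0 ^ 2 * (3 * X 1 ^ 4 + 3 * X 1 ^ 2 * X 0 ^ 3 + X 0 ^ 6) + X 0 ^ 10 * X 3 ^ 4, by rw [hu_def]; ring⟩
  rw [T4PlusFedderData.coeff_pow_eq_of_X_pow_dvd_sub (Finsupp.single 4 4 + Finsupp.single 1 2 + Finsupp.single 3 3) 0 1
    (by simp) hdvd 2]
  have hsq : ((C a * X 4 ^ 4 * X 1 ^ 2 + X 1 ^ 6 + C b * X 3 ^ 3 + C c * X 1 ^ 4) ^ 2 : MvPolynomial (Fin 5) (MvPolynomial (Fin 1) k)) =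
      C (2 * a * b) * (X 4 ^ 4 * X 1 ^ 2 * X 3 ^ 3) + X 4 ^ 5 * (C (a ^ 2) * X 4 ^ 3 * X 1 ^ 4)
        + X 1 ^ 4 * (X 1 ^ 8 + 2 * C a * X 4 ^ 4 * X 1 ^ 4 + 2 * C b * X 1 ^ 2 * X 3 ^ 3
          + C c * C c * X 1 ^ 4 + 2 * C a * C c * X 4 ^ 4 * X 1 ^ 2 + 2 * C c * X 1 ^ 6 + 2 * C b * C c * X 3 ^ 3)
        + X 3 ^ 5 * (C (b ^ 2) * X 3) := by
    rw [map_pow, map_pow, map_mul, map_mul, map_ofNat]; ring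
  have hmono : (X 4 ^ 4 * X 1 ^ 2 * X 3 ^ 3 : MvPolynomial (Fin 5) (MvPolynomial (Fin 1) k)) =
      monomial (Finsupp.single 4 4 + Finsupp.single 1 2 + Finsupp.single 3 3) 1 := by
    rw [X_pow_eq_monomial, X_pow_eq_monomial, X_pow_eq_monomial, monomial_mul, monomial_mul, one_mul, one_mul]
  rw [hsq, coeff_add, coeff_add, coeff_add, HFedderCertificates.coeff_X_pow_mul_eq_zero _ 4 5 (by simp),
    HFedderCertificates.coeff_X_pow_mul_eq_zero _ 1 4 (by simp), HFedderCertificates.coeff_X_pow_mul_eq_zero _ 3 5 (by simp),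
    add_zero, add_zero, add_zero, hmono, coeff_C_mul, coeff_monomial, if_pos rfl, mul_one]

/-- **Direct Fedder certificate, `Fin 6` form**: for `G = X₂² + X₄⁴X₁²X₃⁴ + (X₁² + X₀³)³ + X₁⁴X₃² + X₀¹¹X₅⁴ + X₃⁷X₅³ ∈ k[X₀,…,X₅]` (`X₅ = s`)
over a field of characteristic `5`, at every maximal ideal `Q` of `k[X]/(G)` containing `x̄₀, x̄₁, x̄₂, x̄₄, x̄₅` and NOT `x̄₃`, the local
ring satisfies the Cohen–Macaulay + Frobenius-closed clause (`clause_of_sliceCoeff`, witness `x₄⁴x₁²x₂⁴x₅³`, coefficient `12·x₃¹¹`).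
[cite: Fedder1983, Thm. 1.12] -/
theorem direct_clause_fin6 (k : Type) [Field k] [CharP k 5] (G : MvPolynomial (Fin 6) k)
    (hG : G = X 2 ^ 2 + X 4 ^ 4 * X 1 ^ 2 * X 3 ^ 4 + (X 1 ^ 2 + X 0 ^ 3) ^ 3 + X 1 ^ 4 * X 3 ^ 2 + X 0 ^ 11 * X 5 ^ 4 + X 3 ^ 7 * X 5 ^ 3)
    (Q : Ideal (MvPolynomial (Fin 6) k ⧸ Ideal.span {G})) [Q.IsMaximal]
    (h0 : Ideal.Quotient.mk (Ideal.span {G}) (X 0) ∈ Q) (h1 : Ideal.Quotient.mk (Ideal.span {G}) (X 1) ∈ Q)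
    (h2 : Ideal.Quotient.mk (Ideal.span {G}) (X 2) ∈ Q) (h4 : Ideal.Quotient.mk (Ideal.span {G}) (X 4) ∈ Q)
    (h5 : Ideal.Quotient.mk (Ideal.span {G}) (X 5) ∈ Q) (h3 : Ideal.Quotient.mk (Ideal.span {G}) (X 3) ∉ Q) :
    ∀ d : ℕ, ringKrullDim (Localization.AtPrime Q) = d → ∀ s : Fin d → Localization.AtPrime Q,
      (Ideal.span (Set.range s)).radical.IsMaximal →
        RingTheory.Sequence.IsWeaklyRegular (Localization.AtPrime Q) (List.ofFn s) ∧
        ∀ y : Localization.AtPrime Q, (∃ e : ℕ, y ^ 5 ^ e ∈ Ideal.span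
          ((fun z : Localization.AtPrime Q => z ^ 5 ^ e) ''
            (Ideal.span (Set.range s) : Set (Localization.AtPrime Q)))) → y ∈ Ideal.span (Set.range s) := by
  haveI : Fact (Nat.Prime 5) := ⟨by norm_num⟩
  intro d hd s hs
  have hG0 : G ≠ 0 := by
    rw [hG]; intro h0
    have h1 := congrArg (MvPolynomial.eval ![(0 : k), 0, 1, 0, 0, 0]) h0
    simp at h1
  obtain ⟨Ψ, hΨ0, hΨ1, hΨ2, hΨ3, hΨ4, hΨ5⟩ := RelGddF192Direct.exists_wBaseSlicing6 k
  have hy0 : Ψ.symm (X 0) = X 0 := Ψ.symm_apply_eq.mpr hΨ0.symm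
  have hy1 : Ψ.symm (X 1) = X 1 := Ψ.symm_apply_eq.mpr hΨ1.symm
  have hy2 : Ψ.symm (X 2) = X 2 := Ψ.symm_apply_eq.mpr hΨ2.symm
  have hy3 : Ψ.symm (X 3) = X 5 := Ψ.symm_apply_eq.mpr hΨ5.symm
  have hy4 : Ψ.symm (X 4) = X 4 := Ψ.symm_apply_eq.mpr hΨ4.symm
  have hb0 : Ψ.symm (C (X 0)) = X 3 := Ψ.symm_apply_eq.mpr hΨ3.symm
  have hy : ∀ r : Fin 5, Ψ.symm (X r) ∈ Q.comap (Ideal.Quotient.mk (Ideal.span {G})) := by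
    intro r; fin_cases r
    · exact hy0 ▸ Ideal.mem_comap.mpr h0
    · exact hy1 ▸ Ideal.mem_comap.mpr h1
    · exact hy2 ▸ Ideal.mem_comap.mpr h2
    · exact hy3 ▸ Ideal.mem_comap.mpr h5
    · exact hy4 ▸ Ideal.mem_comap.mpr h4
  have hΨG : Ψ G = X 2 ^ 2 + (C (X 0 ^ 4) * X 4 ^ 4 * X 1 ^ 2 + (X 1 ^ 2 + X 0 ^ 3) ^ 3 + C (X 0 ^ 2) * X 1 ^ 4 + X 0 ^ 11 * X 3 ^ 4 +
      C (X 0 ^ 7) * X 3 ^ 3) := by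
    rw [hG]; simp only [map_add, map_mul, map_pow, hΨ0, hΨ1, hΨ2, hΨ3, hΨ4, hΨ5]; ring
  have hcoeff : coeff (Finsupp.single (2 : Fin 5) (2 * 2) + (Finsupp.single 4 4 + Finsupp.single 1 2 + Finsupp.single 3 3))
      (Ψ (G ^ (5 - 1))) = 12 * (X 0 ^ 11) ^ 1 := by
    rw [map_pow, hΨG, show (5 - 1 : ℕ) = 4 from rfl, coeff_direct]; ring
  have hu : IsUnit (12 : MvPolynomial (Fin 1) k) := by simpa using G5wConeClause.isUnit_natCast_of_not_dvd 5 k 12 (by decide)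
  have hdslice : ∀ r : Fin 5,
      (Finsupp.single (2 : Fin 5) (2 * 2) + (Finsupp.single 4 4 + Finsupp.single 1 2 + Finsupp.single 3 3) : Fin 5 →₀ ℕ) r < 5 := by
    intro r; fin_cases r <;> simp
  haveI h𝔭 : ((Q.comap (Ideal.Quotient.mk (Ideal.span {G}))).comap (Ψ.symm.toRingHom.comp C)).IsPrime := Ideal.comap_isPrime _ _
  have hw : (X 0 ^ 11 : MvPolynomial (Fin 1) k) ∉ (Q.comap (Ideal.Quotient.mk (Ideal.span {G}))).comap (Ψ.symm.toRingHom.comp C) := by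
    intro h
    have h1 := Ideal.mem_comap.mp (h𝔭.mem_of_pow_mem 11 h)
    rw [RingHom.comp_apply, RingEquiv.toRingHom_eq_coe, RingEquiv.coe_toRingHom, hb0] at h1
    exact h3 (Ideal.mem_comap.mp h1)
  exact FedderViaSlicing.clause_of_sliceCoeff 5 k Ψ G hG0 Q hy _ hdslice _ (X 0 ^ 11) hu 1 (by norm_num) hcoeff (Or.inl hw) d hd s hs

/-- **Direct Fedder certificate for the engine's deformation ring** `k[Option (Fin 5)]/(gh)`,
`gh = z² + t⁴y²w⁴ + (y² + x³)³ + y⁴w² + x¹¹s⁴ + w⁷s³` (`s = X none`), `char k = 5`: at every maximal `P′ ∋ x̄, ȳ, z̄, t̄, s̄` with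
`w̄ ∉ P′`, the local ring satisfies the clause — transported from `direct_clause_fin6` along `rename finSuccEquivLast.symm`.
[cite: Fedder1983, Thm. 1.12] -/
theorem direct_clause (k : Type) [Field k] [CharP k 5] (gh : MvPolynomial (Option (Fin 5)) k)
    (hgh : gh = X (some 2) ^ 2 + X (some 4) ^ 4 * X (some 1) ^ 2 * X (some 3) ^ 4 + (X (some 1) ^ 2 + X (some 0) ^ 3) ^ 3
      + X (some 1) ^ 4 * X (some 3) ^ 2 + X (some 0) ^ 11 * X none ^ 4 + X (some 3) ^ 7 * X none ^ 3)
    (P' : Ideal (MvPolynomial (Option (Fin 5)) k ⧸ Ideal.span {gh})) [P'.IsMaximal]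
    (h0 : Ideal.Quotient.mk (Ideal.span {gh}) (X (some 0)) ∈ P') (h1 : Ideal.Quotient.mk (Ideal.span {gh}) (X (some 1)) ∈ P')
    (h2 : Ideal.Quotient.mk (Ideal.span {gh}) (X (some 2)) ∈ P') (h4 : Ideal.Quotient.mk (Ideal.span {gh}) (X (some 4)) ∈ P')
    (hs : Ideal.Quotient.mk (Ideal.span {gh}) (X none) ∈ P') (h3 : Ideal.Quotient.mk (Ideal.span {gh}) (X (some 3)) ∉ P') :
    ∀ d : ℕ, ringKrullDim (Localization.AtPrime P') = d → ∀ t : Fin d → Localization.AtPrime P',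
      (Ideal.span (Set.range t)).radical.IsMaximal →
        RingTheory.Sequence.IsWeaklyRegular (Localization.AtPrime P') (List.ofFn t) ∧
        ∀ y : Localization.AtPrime P', (∃ e : ℕ, y ^ 5 ^ e ∈ Ideal.span
          ((fun z : Localization.AtPrime P' => z ^ 5 ^ e) ''
            (Ideal.span (Set.range t) : Set (Localization.AtPrime P')))) → y ∈ Ideal.span (Set.range t) := by
  -- the renaming `k[Option (Fin 5)] ≃ k[Fin 6]` and the image of `gh`
  set ρ : MvPolynomial (Option (Fin 5)) k ≃+* MvPolynomial (Fin 6) k := (renameEquiv k (finSuccEquivLast (n := 5)).symm).toRingEquiv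
    with hρ
  have hρX : ∀ a, ρ a = rename (finSuccEquivLast (n := 5)).symm a := fun a => rfl
  set G : MvPolynomial (Fin 6) k := X 2 ^ 2 + X 4 ^ 4 * X 1 ^ 2 * X 3 ^ 4 + (X 1 ^ 2 + X 0 ^ 3) ^ 3 + X 1 ^ 4 * X 3 ^ 2 + X 0 ^ 11 * X 5 ^ 4 +
    X 3 ^ 7 * X 5 ^ 3 with hG
  have hρgh : ρ gh = G := by
    rw [hρX, hgh]
    simp only [map_add, map_mul, map_pow, rename_X, finSuccEquivLast_symm_some, finSuccEquivLast_symm_none]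
    rfl
  have hmap : Ideal.span {G} = Ideal.map (ρ : MvPolynomial (Option (Fin 5)) k →+* MvPolynomial (Fin 6) k) (Ideal.span {gh}) := by
    rw [Ideal.map_span, Set.image_singleton]; exact congrArg _ (congrArg _ hρgh.symm)
  set e : (MvPolynomial (Option (Fin 5)) k ⧸ Ideal.span {gh}) ≃+* (MvPolynomial (Fin 6) k ⧸ Ideal.span {G}) :=
    Ideal.quotientEquiv (Ideal.span {gh}) (Ideal.span {G}) ρ hmap with he
  have hemk : ∀ a, e (Ideal.Quotient.mk (Ideal.span {gh}) a) = Ideal.Quotient.mk (Ideal.span {G}) (ρ a) := fun a =>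
    Ideal.quotientEquiv_mk _ _ _ _ a
  -- the corresponding maximal ideal of `k[Fin 6]/(G)`
  set Q : Ideal (MvPolynomial (Fin 6) k ⧸ Ideal.span {G}) := P'.comap e.symm.toRingHom with hQ
  haveI : Q.IsMaximal := Ideal.comap_isMaximal_of_equiv e.symm
  have hXmem : ∀ (o : Option (Fin 5)), Ideal.Quotient.mk (Ideal.span {G}) (X ((finSuccEquivLast (n := 5)).symm o)) ∈ Q ↔
      Ideal.Quotient.mk (Ideal.span {gh}) (X o) ∈ P' := by
    intro o
    rw [hQ, Ideal.mem_comap, RingEquiv.toRingHom_eq_coe, RingEquiv.coe_toRingHom, ← rename_X, ← hρX, ← hemk,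
      RingEquiv.symm_apply_apply]
  have hcl := direct_clause_fin6 k G hG Q
    ((hXmem (some 0)).mpr h0) ((hXmem (some 1)).mpr h1) ((hXmem (some 2)).mpr h2) ((hXmem (some 4)).mpr h4)
    ((hXmem none).mpr hs) (fun h => h3 ((hXmem (some 3)).mp h))
  exact GradedChartClauseAssembly.clause_atPrime_of_ringEquiv 5 e.symm Q P' (fun x => by rw [hQ, Ideal.mem_comap]; rfl) hcl

end Summit.ResolutionOfSingularities.ResolutionOfSingularities.Theorems.FInjectiveMacaulayfication.RelGddF021Direct

end
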